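import Summits.KontsevichZagierPeriods.KontsevichZagierPeriods.Theorems.RootDecompRelativeModAbsoluteEvenCircleP8

/-! # `RootDecompRelativeModAbsoluteEvenCircleP9` — part 9/10 of the mechanical ≤400-line split of `evB_src3.lean` (sha256 9b9fc462830f2800…)
Source: decomp-kz lens-3 g14 EvenCircle.lean FINAL @ba0f3b57 §K0–§K12 (land/EvenCircleB @954ab641, lint-fixed, §K12 re-pointed at the landed CircleSplit names; critic CLEARED g7-2 l.1388: evenCircleCellClose_holds); --supports stmt-KontsevichZagierPeriods-30572.
Split by census-1 g10 `gen/splitlean.py`: scopes re-opened with their `open`/`variable`/`set_option` context; mathematics and declaration order unchanged. -/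

noncomputable section
open Set MeasureTheory
open Literature.NumberTheory.Transcendental Literature.ModelTheory.ExponentialFields
namespace Summit.KontsevichZagierPeriods.RootDecompRelativeModAbsolute.Rung30571.RegularisedLogLayer.CylLog.Leaf.G13
namespace AngleFold

/-- **MAIN THEOREM (bounded base).**  `EvenCircleCellClose` for bounded `E`, stated over the local copies `sqPolyK`/`sqTransK`
of `CircleSplit.sqPoly`/`sqTrans` (same bodies). -/
theorem evenCircle_bdd (E : Set (Fin 1 → ℝ)) (V : KZ.IntegralRep (1 + 1)) (a₀ : (Fin 1 → ℝ) → ℝ) (q : ℕ)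
    (c κ : Fin q → (Fin 1 → ℝ) → ℝ) (M : Fin q → ℕ) (S : ℕ) (f' : Fin S → Fin q → ℤ) (m : Fin S → ℚ)
    (qq' : Fin S → (Fin 1 → ℝ) → ℝ) (hEo : IsOpen E) (hE : IsSemialgebraic ℚ E) (ha₀ : IsSemialgebraicFunOn ℚ E a₀)
    (ha₀I : IntegrableOn a₀ E) (hc : ∀ i, IsSemialgebraicFunOn ℚ E (c i)) (_hcs : ∀ i, ContDiffOn ℝ (⊤ : ℕ∞) (c i) E)
    (hκ : ∀ i, IsSemialgebraicFunOn ℚ E (κ i)) (hκs : ∀ i, ContDiffOn ℝ (⊤ : ℕ∞) (κ i) E) (hM : ∀ i, M i % 2 = 0)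
    (hκ0 : ∀ i, ∀ x ∈ E, 0 < κ i x)
    (hI1 : ∀ i, IntegrableOn (fun z : Fin (1 + 1) → ℝ =>
        c i (Fin.init z) * (z (Fin.last 1) ^ M i / (1 + z (Fin.last 1) ^ 2 * κ i (Fin.init z))))
      {z : Fin (1 + 1) → ℝ | Fin.init z ∈ E ∧ z (Fin.last 1) ∈ Set.Ioo 0 1})
    (hI2 : ∀ i, IntegrableOn (fun x => c i x * ∫ θ in Set.Ioo (0:ℝ) 1, θ ^ M i / (1 + θ ^ 2 * κ i x)) E)
    (hVd : V.domain = {z : Fin (1 + 1) → ℝ | Fin.init z ∈ E ∧ z (Fin.last 1) ∈ Set.Ioo 0 1})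
    (hVi : Set.EqOn V.integrand (fun z => a₀ (Fin.init z) +
      ∑ i, c i (Fin.init z) * (z (Fin.last 1) ^ M i / (1 + z (Fin.last 1) ^ 2 * κ i (Fin.init z)))) V.domain)
    (hzero : ∀ x ∈ E, a₀ x + ∑ i, c i x * sqPolyK 0 (M i / 2) (κ i x) = 0)
    (_hqq : ∀ s, IsSemialgebraicFunOn ℚ E (qq' s))
    (hrel : ∀ s, ∀ x ∈ E, ∑ i, (f' s i : ℝ) * Real.arctan (Real.sqrt (κ i x)) = (m s : ℝ) * Real.pi)
    (hbud : ∀ x ∈ E, ∑ s, qq' s x * (m s : ℝ) = 0)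
    (hpq : ∀ i, ∀ x ∈ E, c i x * sqTransK 0 (M i / 2) (κ i x) / Real.sqrt (κ i x) = ∑ s, qq' s x * (f' s i : ℝ))
    (hbb : BddBelow (bpt ⁻¹' E)) (hba : BddAbove (bpt ⁻¹' E)) :
    KZ.of V ∈ KZ.relations := by
  classical
  have hEm : MeasurableSet E := IsSemialgebraic.measurableSet_holds hE
  have hMn : ∀ i, M i = 2 * (M i / 2) := fun i => by have := Nat.div_add_mod (M i) 2; rw [hM i] at this; omega
  have hu0 : ∀ i, ∀ x ∈ E, 0 < Real.sqrt (κ i x) := fun i x hx => Real.sqrt_pos.2 (hκ0 i x hx)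
  have husq : ∀ i, ∀ x ∈ E, Real.sqrt (κ i x) ^ 2 = κ i x := fun i x hx => Real.sq_sqrt (hκ0 i x hx).le
  have husa : ∀ i, IsSemialgebraicFunOn ℚ E (fun x => Real.sqrt (κ i x)) := fun i =>
    IsSemialgebraicFunOn.sqrt_holds (hκ i)
  have hud : ∀ i, ∀ x ∈ E, DifferentiableAt ℝ (fun x => Real.sqrt (κ i x)) x := fun i x hx =>
    (((hκs i).differentiableOn (by simp)).differentiableAt (hEo.mem_nhds hx)).sqrt (hκ0 i x hx).ne'
  have hpsa : ∀ i, IsSemialgebraicFunOn ℚ E (fun x => c i x / Real.sqrt (κ i x) ^ (2 * (M i / 2) + 1)) := fun i =>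
    IsSemialgebraicFunOn.div (hc i) ((husa i).fun_pow _) fun x hx => pow_ne_zero _ (hu0 i x hx).ne'
  have hVE : V.domain ⊆ {w : Fin 2 → ℝ | Fin.init w ∈ E} := fun z hz => by rw [hVd] at hz; exact hz.1
  have hVm : MeasurableSet V.domain := IsSemialgebraic.measurableSet_holds V.isSemialgebraic_domain
  -- the pieces `B_i` on `V.domain`
  have hBsa : ∀ i, IsSemialgebraicFunOn ℚ V.domain
      (fun z => c i (Fin.init z) * (z (Fin.last 1) ^ M i / (1 + z (Fin.last 1) ^ 2 * κ i (Fin.init z)))) := by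
    intro i
    have hl : IsSemialgebraicFunOn ℚ V.domain (fun z => z (Fin.last 1)) :=
      Literature.NumberTheory.Transcendental.isSemialgebraicFunOn_apply V.isSemialgebraic_domain (Fin.last 1)
    have h1 : IsSemialgebraicFunOn ℚ V.domain (fun _ => (1:ℝ)) := saConst_one V.isSemialgebraic_domain
    have hden : IsSemialgebraicFunOn ℚ V.domain (fun z => 1 + z (Fin.last 1) ^ 2 * κ i (Fin.init z)) :=
      IsSemialgebraicFunOn.add_holds h1 ((hl.fun_pow 2).mul_holds ((hκ i).comp_init.mono hVE V.isSemialgebraic_domain))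
    refine ((hc i).comp_init.mono hVE V.isSemialgebraic_domain).mul_holds
      (IsSemialgebraicFunOn.div (hl.fun_pow (M i)) hden fun z hz => ?_)
    have := mul_nonneg (sq_nonneg (z (Fin.last 1))) (hκ0 i _ (hVE hz)).le
    linarith
  have hBint : ∀ i, IntegrableOn
      (fun z => c i (Fin.init z) * (z (Fin.last 1) ^ M i / (1 + z (Fin.last 1) ^ 2 * κ i (Fin.init z)))) V.domain :=
    fun i => by rw [hVd]; exact hI1 i
  let B : Fin q → KZ.IntegralRep 2 := fun i =>
    ⟨V.domain, fun z => c i (Fin.init z) * (z (Fin.last 1) ^ M i / (1 + z (Fin.last 1) ^ 2 * κ i (Fin.init z))),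
      V.isSemialgebraic_domain, hBsa i, hBint i⟩
  -- the base piece `B₀` on `V.domain`
  have hB₀int : IntegrableOn (fun z => a₀ (Fin.init z)) V.domain := by
    refine (V.integrableOn.sub (MeasureTheory.integrable_finsetSum Finset.univ fun i _ => hBint i)).congr_fun (fun z hz => ?_) hVm
    simp only [Pi.sub_apply]   -- may be a no-op
    rw [hVi hz]
    simp only
    ring
  let B₀ : KZ.IntegralRep 2 := ⟨V.domain, fun z => a₀ (Fin.init z), V.isSemialgebraic_domain,
    ha₀.comp_init.mono hVE V.isSemialgebraic_domain, hB₀int⟩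
  have rV : KZ.of V - KZ.of B₀ - ∑ i, KZ.of (B i) ∈ KZ.relations :=
    KZ.of_sub_of_sub_sum_mem_relations q V B₀ B rfl (fun i => rfl) fun z hz => by rw [hVi hz]
  -- `B₀ = ⟦E; a₀⟧`
  let A₀ : KZ.IntegralRep 1 := ⟨E, a₀, hE, ha₀, ha₀I⟩
  have eB₀ : cl B₀ = cl A₀ := by
    let Bc : KZ.IntegralRep 2 := polyRep hE (saConst_one hE) ha₀ 1 (fun _ _ => zero_le_one)
      (ha₀I.mul_const _) (ha₀I.mul_const _)
    have hBcd : Bc.domain = KZlog.band E (fun _ => 0) (fun _ => 1) := rfl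
    have hsubV : V.domain ⊆ Bc.domain := fun z hz => by
      rw [hVd] at hz; rw [hBcd]; exact ⟨hz.1, hz.2.1.le, hz.2.2.le⟩
    have hvolV : volume (Bc.domain \ V.domain) = 0 := by
      refine measure_mono_null (fun w hw => ?_)
        (measure_union_null (KZ.volume_setOf_last_eq_zero (n := 1) (0:ℝ)) (KZ.volume_setOf_last_eq_zero (n := 1) (1:ℝ)))
      obtain ⟨hw, hnot⟩ := hw
      rw [hBcd] at hw
      rw [hVd] at hnot
      obtain ⟨hx, h0, h1⟩ := hw
      by_cases h0' : w (Fin.last 1) = 0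
      · exact Or.inl h0'
      · right
        show w (Fin.last 1) = 1
        by_contra h1'
        exact hnot ⟨hx, lt_of_le_of_ne h0 (Ne.symm h0'), lt_of_le_of_ne h1 h1'⟩
    have rA : KZ.of Bc - KZ.of (Bc.restrict _ V.isSemialgebraic_domain hsubV) ∈ KZ.relations :=
      Bc.of_sub_of_restrict_mem_relations V.isSemialgebraic_domain hsubV hvolV
    have rB : KZ.of (Bc.restrict _ V.isSemialgebraic_domain hsubV) - KZ.of B₀ ∈ KZ.relations :=
      KZ.of_sub_of_mem_relations_of_eqOn rfl fun z _ => by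
        show a₀ (Fin.init z) * qk 1 (z (Fin.last 1)) = a₀ (Fin.init z)
        simp [qk]
    have rC : KZ.of Bc - KZ.of A₀ ∈ KZ.relations :=
      poly_unfold hE 1 ha₀ (saConst_one hE) (fun _ _ => zero_le_one) Bc rfl (fun _ _ => rfl) A₀ rfl fun x _ => by
        show a₀ x = a₀ x * Qk 1 1
        norm_num [Qk]
    show mk (KZ.of B₀) = mk (KZ.of A₀)
    rw [← mk_sub_eq rB, ← mk_sub_eq rA, mk_sub_eq rC]
  -- `B_i = ⟦band E 0 √κ_i; p_i g_{n_i}⟧`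
  have hint : ∀ i, IntegrableOn (fun x => c i x / Real.sqrt (κ i x) ^ (2 * (M i / 2) + 1) *
      Gn (M i / 2) (Real.sqrt (κ i x))) E := fun i => by
    refine (hI2 i).congr_fun (fun x hx => ?_) hEm
    have e : (fun θ : ℝ => θ ^ M i / (1 + θ ^ 2 * κ i x)) =
        fun θ => θ ^ (2 * (M i / 2)) / (1 + θ ^ 2 * Real.sqrt (κ i x) ^ 2) := by
      funext θ; rw [← hMn i, husq i x hx]
    show c i x * ∫ θ in Set.Ioo (0:ℝ) 1, θ ^ M i / (1 + θ ^ 2 * κ i x) = _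
    rw [e, integral_circ_fibre (M i / 2) (hu0 i x hx)]
    ring
  choose A hAd hAi eB using fun i => scale_piece hE (M i / 2) (hc i) (husa i) (hu0 i) (hud i) (B i) hVd
    (fun z hz => by
      show c i (Fin.init z) * (z (Fin.last 1) ^ M i / (1 + z (Fin.last 1) ^ 2 * κ i (Fin.init z))) =
        c i (Fin.init z) * (z (Fin.last 1) ^ (2 * (M i / 2)) / (1 + z (Fin.last 1) ^ 2 * Real.sqrt (κ i (Fin.init z)) ^ 2))
      rw [husq i _ (hVE hz), ← hMn i])
    (hint i)
  -- the engine
  have hmain := cell_fold_even hE hEo hbb hba (fun i => M i / 2)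
    (p := fun i x => c i x / Real.sqrt (κ i x) ^ (2 * (M i / 2) + 1)) (u := fun i x => Real.sqrt (κ i x))
    hpsa husa (fun i x hx => (hu0 i x hx).le) A hAd (fun i z _ => by rw [hAi i]) hint A₀ rfl (a₀ := a₀)
    (fun _ _ => rfl)
    (fun x hx => by
      rw [← hzero x hx]
      refine congrArg _ (Finset.sum_congr rfl fun i _ => ?_)
      show c i x / Real.sqrt (κ i x) ^ (2 * (M i / 2) + 1) * Qk (M i / 2) (Real.sqrt (κ i x)) =
        c i x * sqPolyK 0 (M i / 2) (κ i x)
      rw [Qk_eq_sqPolyK _ (hu0 i x hx), husq i x hx]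
      have hun : Real.sqrt (κ i x) ^ (2 * (M i / 2) + 1) ≠ 0 := pow_ne_zero _ (hu0 i x hx).ne'
      field_simp)
    f' m qq' hrel hbud
    (fun i x hx => by
      have h := hpq i x hx
      rw [← h]
      have hv := hu0 i x hx
      have hsq := husq i x hx
      set v := Real.sqrt (κ i x) with hv_def
      show (-1) ^ (M i / 2) * (c i x / v ^ (2 * (M i / 2) + 1)) = c i x * sqTransK 0 (M i / 2) (κ i x) / v
      rw [← hsq, sqTransK_zero_sq _ hv]
      have hvn : v ^ (2 * (M i / 2)) ≠ 0 := pow_ne_zero _ hv.ne'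
      rw [pow_succ]
      field_simp)
  -- assemble
  have e1 : cl V = cl B₀ + ∑ i, cl (B i) := by
    rw [sub_sub] at rV
    have := mk_sub_eq rV
    rwa [map_add, map_sum] at this
  have e2 : cl A₀ + ∑ i, cl (A i) = 0 := by
    have := (mk_eq_zero_iff).2 hmain
    rwa [map_add, map_sum] at this
  apply (mk_eq_zero_iff).1
  show cl V = 0
  rw [e1, eB₀, Finset.sum_congr rfl fun i _ => eB i]
  exact e2

/-! ### §K11 Unbounded base cells: the inversion `x = 1/y` (rule 2 on the base coordinate) and the MAIN THEOREM. -/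

/-- The open box `E × (0,1)` over a semialgebraic base is semialgebraic. -/
theorem sa_box {E : Set (Fin 1 → ℝ)} (hE : IsSemialgebraic ℚ E) :
    IsSemialgebraic ℚ {z : Fin 2 → ℝ | Fin.init z ∈ E ∧ z (Fin.last 1) ∈ Ioo (0:ℝ) 1} := by
  have hB := isSemialgebraic_initMem hE
  have hl : IsSemialgebraicFunOn ℚ {w : Fin 2 → ℝ | Fin.init w ∈ E} (fun w => w (Fin.last 1)) :=
    Literature.NumberTheory.Transcendental.isSemialgebraicFunOn_apply hB (Fin.last 1)
  have h1 := hl.neg.isSemialgebraic_sep_neg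
  have h2 := (IsSemialgebraicFunOn.sub_holds hl (saConst_one hB)).isSemialgebraic_sep_neg
  convert h1.inter h2 using 1
  ext z
  simp only [mem_setOf_eq, mem_inter_iff, mem_Ioo, Pi.neg_apply, Pi.sub_apply]
  constructor
  · rintro ⟨hx, h0, h1⟩; exact ⟨⟨hx, by linarith⟩, ⟨hx, by linarith⟩⟩
  · rintro ⟨⟨hx, h0⟩, ⟨_, h1⟩⟩; exact ⟨hx, by linarith, by linarith⟩

/-- Inversion of the base coordinate. -/
def binv (y : Fin 1 → ℝ) : Fin 1 → ℝ := fun _ => (y 0)⁻¹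

/-- Auxiliary step `binv_apply` (§K11): binv apply. [bookkeeping] -/
theorem binv_apply (y : Fin 1 → ℝ) (i : Fin 1) : binv y i = (y 0)⁻¹ := rfl

/-- Auxiliary step `binv_invol` (§K11): binv invol. [bookkeeping] -/
theorem binv_invol (y : Fin 1 → ℝ) : binv (binv y) = y := by
  funext i; rw [Subsingleton.elim i 0]; simp [binv]

/-- Auxiliary step `isSemialgebraicMapOn_binv` (§K11): is Semialgebraic Map On binv. [bookkeeping] -/
theorem isSemialgebraicMapOn_binv {S : Set (Fin 1 → ℝ)} (hS : IsSemialgebraic ℚ S) (h0 : ∀ y ∈ S, y 0 ≠ 0) :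
    IsSemialgebraicMapOn ℚ S binv :=
  IsSemialgebraicMapOn.of_forall hS fun _ =>
    (Literature.NumberTheory.Transcendental.isSemialgebraicFunOn_apply hS 0).inv h0

/-- Auxiliary step `hasFDerivAt_binv` (§K11): has FDeriv At binv. [bookkeeping] -/
theorem hasFDerivAt_binv {y : Fin 1 → ℝ} (hy : y 0 ≠ 0) :
    HasFDerivAt binv (flipLin 1 (fun _ => -(y 0 ^ 2)⁻¹)) y := by
  refine hasFDerivAt_pi'.2 fun i => ?_
  have h := (hasFDerivAt_inv hy).comp y (hasFDerivAt_apply (𝕜 := ℝ) (0 : Fin 1) y)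
  refine h.congr_fderiv (ContinuousLinearMap.ext fun z => ?_)
  rw [Subsingleton.elim i 0]
  simp [flipLin_apply, mul_comm]

/-- Auxiliary step `continuousOn_binv` (§K11): continuous On binv. [bookkeeping] -/
theorem continuousOn_binv : ContinuousOn binv {y : Fin 1 → ℝ | y 0 ≠ 0} :=
  continuousOn_pi.2 fun _ => ((continuous_apply 0).continuousOn.inv₀ fun _ hy => hy)

/-- `∫_{binv '' S} g = ∫_S g ∘ binv · y⁻²` (integrability form). -/
theorem integrableOn_binv {S : Set (Fin 1 → ℝ)} (hSm : MeasurableSet S) (h0 : ∀ y ∈ S, y 0 ≠ 0)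
    (g : (Fin 1 → ℝ) → ℝ) :
    IntegrableOn g (binv '' S) ↔ IntegrableOn (fun y => (y 0 ^ 2)⁻¹ * g (binv y)) S := by
  have h := integrableOn_image_iff_integrableOn_abs_det_fderiv_smul volume hSm
    (fun y hy => (hasFDerivAt_binv (h0 y hy)).hasFDerivWithinAt)
    (fun x _ y _ hxy => by rw [← binv_invol x, ← binv_invol y]; exact congrArg binv hxy) g
  rw [h]
  refine integrableOn_congr_fun (fun y _ => ?_) hSm
  rw [det_flipLin, smul_eq_mul]
  simp [abs_inv]

/-- Inversion of the base coordinate on `ℝ¹ × ℝ`. -/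
def binv2 (w : Fin 2 → ℝ) : Fin 2 → ℝ := ![(w 0)⁻¹, w 1]

/-- Auxiliary step `binv2_zero` (§K11): binv2 zero. [bookkeeping] -/
theorem binv2_zero (w : Fin 2 → ℝ) : binv2 w 0 = (w 0)⁻¹ := by simp [binv2]
/-- Auxiliary step `binv2_last` (§K11): binv2 last. [bookkeeping] -/
theorem binv2_last (w : Fin 2 → ℝ) : binv2 w (Fin.last 1) = w (Fin.last 1) := by
  simp [binv2, show (Fin.last 1 : Fin 2) = 1 from rfl]
/-- Auxiliary step `init_binv2` (§K11): init binv2. [bookkeeping] -/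
theorem init_binv2 (w : Fin 2 → ℝ) : Fin.init (binv2 w) = binv (Fin.init w) := by
  funext i; rw [Subsingleton.elim i 0]; simp [Fin.init, binv, binv2]

/-- Auxiliary step `binv2_invol` (§K11): binv2 invol. [bookkeeping] -/
theorem binv2_invol (w : Fin 2 → ℝ) : binv2 (binv2 w) = w := by
  funext i
  refine Fin.cases ?_ (fun j => ?_) i
  · simp [binv2]
  · rw [Subsingleton.elim j 0]; simp [binv2]

/-- Auxiliary step `isSemialgebraicMapOn_binv2` (§K11): is Semialgebraic Map On binv2. [bookkeeping] -/
theorem isSemialgebraicMapOn_binv2 {S : Set (Fin 2 → ℝ)} (hS : IsSemialgebraic ℚ S) (h0 : ∀ w ∈ S, w 0 ≠ 0) :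
    IsSemialgebraicMapOn ℚ S binv2 := by
  refine IsSemialgebraicMapOn.of_forall hS (Fin.forall_fin_two.2 ⟨?_, ?_⟩)
  · exact ((Literature.NumberTheory.Transcendental.isSemialgebraicFunOn_apply hS 0).inv h0).congr
      fun w _ => (binv2_zero w).symm
  · exact (Literature.NumberTheory.Transcendental.isSemialgebraicFunOn_apply hS 1).congr
      fun w _ => by simp [binv2]

/-- Auxiliary step `hasFDerivAt_binv2` (§K11): has FDeriv At binv2. [bookkeeping] -/
theorem hasFDerivAt_binv2 {w : Fin 2 → ℝ} (hw : w 0 ≠ 0) :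
    HasFDerivAt binv2 (flipLin 2 ![-(w 0 ^ 2)⁻¹, 1]) w := by
  refine hasFDerivAt_pi'.2 (Fin.forall_fin_two.2 ⟨?_, ?_⟩)
  · have e : (fun x : Fin 2 → ℝ => binv2 x 0) = fun x => (x 0)⁻¹ := funext fun x => binv2_zero x
    rw [e]
    have h := (hasFDerivAt_inv hw).comp w (hasFDerivAt_apply (𝕜 := ℝ) (0 : Fin 2) w)
    refine h.congr_fderiv (ContinuousLinearMap.ext fun z => ?_)
    simp [flipLin_apply, mul_comm]
  · have e : (fun x : Fin 2 → ℝ => binv2 x 1) = fun x => x 1 := funext fun x => by simp [binv2]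
    rw [e]
    refine (hasFDerivAt_apply (𝕜 := ℝ) (1 : Fin 2) w).congr_fderiv (ContinuousLinearMap.ext fun z => ?_)
    simp [flipLin_apply]

/-- Auxiliary step `abs_det_binv2'` (§K11): abs det binv2'. [bookkeeping] -/
theorem abs_det_binv2' (w : Fin 2 → ℝ) : |(flipLin 2 ![-(w 0 ^ 2)⁻¹, 1]).det| = (w 0 ^ 2)⁻¹ := by
  rw [det_flipLin, Fin.prod_univ_two]
  simp [abs_inv]

/-- Auxiliary step `integrableOn_binv2` (§K11): integrable On binv2. [bookkeeping] -/
theorem integrableOn_binv2 {S : Set (Fin 2 → ℝ)} (hSm : MeasurableSet S) (h0 : ∀ w ∈ S, w 0 ≠ 0)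
    (g : (Fin 2 → ℝ) → ℝ) :
    IntegrableOn g (binv2 '' S) ↔ IntegrableOn (fun w => (w 0 ^ 2)⁻¹ * g (binv2 w)) S := by
  have h := integrableOn_image_iff_integrableOn_abs_det_fderiv_smul volume hSm
    (fun w hw => (hasFDerivAt_binv2 (h0 w hw)).hasFDerivWithinAt)
    (fun x _ y _ hxy => by rw [← binv2_invol x, ← binv2_invol y]; exact congrArg binv2 hxy) g
  rw [h]
  refine integrableOn_congr_fun (fun w _ => ?_) hSm
  rw [abs_det_binv2', smul_eq_mul]

/-- Auxiliary step `volume_setOf_zero_eq_zero` (§K11): volume set Of zero eq zero. [bookkeeping] -/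
private theorem volume_setOf_zero_eq_zero (c : ℝ) : volume {z : Fin 2 → ℝ | z 0 = c} = 0 := by
  rw [volume_pi]
  exact Measure.pi_hyperplane _ _ _

end AngleFold
end Summit.KontsevichZagierPeriods.RootDecompRelativeModAbsolute.Rung30571.RegularisedLogLayer.CylLog.Leaf.G13
end
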